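import Mathlib.Analysis.Analytic.OfScalars
import Mathlib.Analysis.Analytic.ChangeOrigin
import Mathlib.Analysis.Calculus.SmoothSeries
import Mathlib.Analysis.Normed.Ring.InfiniteSum
import Mathlib.Analysis.SpecificLimits.Normed
import Mathlib.Analysis.Calculus.Deriv.Pow
import Mathlib.Combinatorics.Enumerative.Catalan.Basic
import Mathlib.Tactic.IntervalCases
import Mathlib.Analysis.Calculus.Deriv.Inverse
import Literature.Analysis.FluidPDE.CompressibleEulerImplosionSonicSeries
import HarnessLib

/-!
# Buckmaster–Cao-Labora–Gómez-Serrano at `γ = 5/3`: the smooth branch through `P_s` is analytic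

Topic `Literature/Analysis/FluidPDE`; namespace
`Literature.Analysis.FluidPDE.BuckmasterCaolaboraGomezserrano2025.Monatomic.SonicSeries`. Sequel of
`CompressibleEulerImplosionSonicSeries.lean` (Brick C1 part 1: the Taylor recursion (2.9)–(2.10)
at the sonic point `P_s` in ordinary coefficients `wₙ, zₙ`, and the coefficientwise identities
`EW_wz`, `EZfull_wz`), companion of `CompressibleEulerImplosion.lean` (named fact
`BuckmasterCaolaboraGomezserrano2025_thm11_monatomic`, THEOREM 1.1 of T. Buckmaster,
G. Cao-Labora, J. Gómez-Serrano, *Smooth imploding solutions for 3D compressible fluids*,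
Forum Math. Pi 13 (2025) e6, arXiv:2208.09445, at `γ = 5/3`, `α = 1/3`).

Brick C1 parts 2–3 of the discharge plan — Propositions 2.2–2.3 ("the smooth solution through
`P_s` tangent to `ν₋` is given by a convergent power series"), for `r ∈ (r₃, r₄)`:

* Part 2 (Prop. 2.3, convergence): an abstract Catalan-majorant lemma (the elementary Catalan
  facts are re-derived inline, as in `CompressibleEulerImplosionOriginSeries.lean`)
  (`exists_catalan_majorant`) and the coefficient inequality for `aₙ = |wₙ| + |zₙ|` derived from
  the recursion (`av_rec`; the denominators `D_{Z,1}(n − k)` are controlled by `3 < k < 4`,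
  `exists_slope_bound`) give the geometric bound `aₙ ≤ K Mⁿ` (`exists_av_le_geom`);
* Part 3 (summation): `W^{(r)}(ξ) = Σ wₙ ξⁿ` (`Wloc`), `Z^{(r)}(ξ) = Σ zₙ ξⁿ` (`Zloc`) converge
  for `|ξ| < 1/(2M)`, are real-analytic, pass through `P_s` with velocity `(W₁, Z₁)` and solve
  the autonomous system (1.8): `D_W(W,Z) W′ = N_W(W,Z)`, `D_Z(W,Z) Z′ = N_Z(W,Z)`
  (`sonicSeries_spec'` with the explicit radius `sonicRad r = 1/(2 geoM r)`, all majorant constants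
  being explicit — `slopeK`, `recQ`, `geoK`, `geoM` — for the `r`-uniformity needed later).

Real definitions with bodies + theorems; no facts. (The paper proves convergence by the same
kind of majorant argument; continuity in `r` and the sign information of Cor. 2.4 are not in this
file.) [cite: BuckmasterCaolaboraGomezserrano2025, §2.2, Prop. 2.2, Prop. 2.3]
-/

noncomputable section

open Finset Filter Topology

namespace Literature.Analysis.FluidPDE

namespace BuckmasterCaolaboraGomezserrano2025

namespace Monatomic

namespace SonicSeries

variable {r : ℝ}

/-! ## Part 2 — Proposition 2.3: a Catalan majorant for the coefficients

We bound `aₙ := |wₙ| + |zₙ|` geometrically. From the recursion (`w_succ_succ`, `z_succ_succ`)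
one gets, for every `n`,
`a_{n+2} ≤ Q (a_{n+1} + Σ_{k<n} a_{k+1} a_{n−k} + Σ_{k≤n} a_{k+1} a_{n+1−k} + Σ_{k<n} a_{k+2} a_{n+1−k})`
(the last sum, with index sum `n + 3`, comes from `D_Z(P_s) = 0`), and an abstract majorant
argument (`exists_catalan_majorant`: `aₘ ≤ B 𝔠_{m−2} λ^{m−2}` for `m ≥ 2`) gives
`aₙ ≤ K Mⁿ`. This is the convergence statement of Proposition 2.3 at `γ = 5/3` (the paper bounds
the same recursion by the same Catalan-type majorant). [cite: BuckmasterCaolaboraGomezserrano2025, Prop. 2.3]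
-/

/-! ### The abstract majorant lemma -/

/-- Catalan's convolution identity over `ℝ`: `∑_{k≤n} 𝔠_k 𝔠_{n−k} = 𝔠_{n+1}`. [folklore] -/
theorem catalan_conv (n : ℕ) :
    ∑ k ∈ range (n + 1), (catalan k : ℝ) * catalan (n - k) = catalan (n + 1) := by
  have h : ∑ k ∈ range (n + 1), catalan k * catalan (n - k) = catalan (n + 1) := by
    rw [catalan_succ', Nat.sum_antidiagonal_eq_sum_range_succ (fun i j => catalan i * catalan j)]
  exact_mod_cast h

/-- **Abstract Catalan majorant.** A nonnegative sequence with
`a_{n+2} ≤ Q (a_{n+1} + Σ_{k<n} a_{k+1}a_{n−k} + Σ_{k≤n} a_{k+1}a_{n+1−k} + Σ_{k<n} a_{k+2}a_{n+1−k})`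
satisfies `aₘ ≤ B 𝔠_{m−2} λ^{m−2}` for `m ≥ 2`, for suitable `B, λ ≥ 1`.
[cite: BuckmasterCaolaboraGomezserrano2025, proof of Prop. 2.3] -/
theorem catalan_majorant {a : ℕ → ℝ} (ha : ∀ n, 0 ≤ a n) {Q : ℝ} (hQ : 0 ≤ Q)
    (hrec : ∀ n : ℕ, a (n + 2) ≤ Q * (a (n + 1)
      + ∑ k ∈ range n, a (k + 1) * a (n - k)
      + ∑ k ∈ range (n + 1), a (k + 1) * a (n + 1 - k)
      + ∑ k ∈ range n, a (k + 2) * a (n + 1 - k))) :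
    ∀ m : ℕ, 2 ≤ m → a m ≤ (1 + a 2 + a 1 ^ 2) * catalan (m - 2)
      * (1 + Q * (1 + 4 * a 1 + 3 * (1 + a 2 + a 1 ^ 2))) ^ (m - 2) := by
  -- the constants
  set A₁ : ℝ := a 1 with hA₁
  set B : ℝ := 1 + a 2 + A₁ ^ 2 with hB
  set L : ℝ := 1 + Q * (1 + 4 * A₁ + 3 * B) with hL
  have hA₁0 : 0 ≤ A₁ := ha 1
  have hB1 : 1 ≤ B := by have := ha 2; rw [hB]; nlinarith
  have hB0 : 0 ≤ B := zero_le_one.trans hB1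
  have hL1 : 1 ≤ L := by rw [hL]; nlinarith
  have hL0 : 0 < L := zero_lt_one.trans_le hL1
  have hcat0 : ∀ i : ℕ, (0 : ℝ) ≤ catalan i := fun i => Nat.cast_nonneg _
  have catalan_le_succ : ∀ n : ℕ, (catalan n : ℝ) ≤ catalan (n + 1) := by
    intro n
    -- `(n+2) 𝔠ₙ₊₁ = 2(2n+1) 𝔠ₙ` from `(n+1) 𝔠ₙ = C(2n, n)`
    have hmul : (n + 2) * catalan (n + 1) = 2 * (2 * n + 1) * catalan n := by
      have h1 := succ_mul_catalan_eq_centralBinom (n + 1)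
      have h2 := succ_mul_catalan_eq_centralBinom n
      have h3 := Nat.succ_mul_centralBinom_succ n
      apply Nat.eq_of_mul_eq_mul_left (Nat.succ_pos n)
      calc (n + 1) * ((n + 2) * catalan (n + 1)) = (n + 1) * (n + 1).centralBinom := by rw [← h1]
        _ = 2 * (2 * n + 1) * n.centralBinom := h3
        _ = 2 * (2 * n + 1) * ((n + 1) * catalan n) := by rw [h2]
        _ = (n + 1) * (2 * (2 * n + 1) * catalan n) := by ring
    have h' : ((n : ℝ) + 2) * catalan (n + 1) = 2 * (2 * n + 1) * catalan n := by
      exact_mod_cast hmul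
    have hc : (0 : ℝ) ≤ catalan (n + 1) := Nat.cast_nonneg _
    nlinarith
  have catalan_mono : ∀ {i j : ℕ}, i ≤ j → (catalan i : ℝ) ≤ catalan j := fun hij =>
    monotone_nat_of_le_succ catalan_le_succ hij
  -- the majorant `T i = B 𝔠_{i-2} L^{i-2}` and its monotonicity in the exponent data
  have hmono : ∀ {i j : ℕ}, i ≤ j → B * catalan i * L ^ i ≤ B * catalan j * L ^ j :=
    fun hij => mul_le_mul (mul_le_mul_of_nonneg_left (catalan_mono hij) hB0)
      (pow_le_pow_right₀ hL1 hij) (by positivity) (by positivity)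
  -- the convolution bound: all indices in `[2, M+2]`
  have hconv : ∀ M : ℕ, (∀ i, 2 ≤ i → i ≤ M + 2 → a i ≤ B * catalan (i - 2) * L ^ (i - 2)) →
      ∑ k ∈ range (M + 1), a (k + 2) * a (M + 2 - k) ≤ B ^ 2 * catalan (M + 1) * L ^ M := by
    intro M hI
    calc ∑ k ∈ range (M + 1), a (k + 2) * a (M + 2 - k)
        ≤ ∑ k ∈ range (M + 1), (B * catalan k * L ^ k) * (B * catalan (M - k) * L ^ (M - k)) := by
          refine sum_le_sum fun k hk => ?_
          rw [mem_range] at hk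
          have h1 := hI (k + 2) (by omega) (by omega)
          have h2 := hI (M + 2 - k) (by omega) (by omega)
          rw [Nat.add_sub_cancel] at h1
          rw [show M + 2 - k - 2 = M - k from by omega] at h2
          exact mul_le_mul h1 h2 (ha _) (by positivity)
      _ = B ^ 2 * L ^ M * ∑ k ∈ range (M + 1), (catalan k : ℝ) * catalan (M - k) := by
          rw [mul_sum]
          refine sum_congr rfl fun k hk => ?_
          rw [mem_range] at hk
          rw [← pow_mul_pow_sub L (Nat.lt_succ_iff.mp hk)]
          ring
      _ = B ^ 2 * catalan (M + 1) * L ^ M := by rw [catalan_conv]; ring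
  -- the same with one unit of slack in the exponent (covers the empty case)
  have hconv' : ∀ M : ℕ, (∀ i, 2 ≤ i → i ≤ M + 1 → a i ≤ B * catalan (i - 2) * L ^ (i - 2)) →
      ∑ k ∈ range M, a (k + 2) * a (M + 1 - k) ≤ B ^ 2 * catalan M * L ^ M := by
    intro M hI
    rcases M with _ | M
    · simp; positivity
    · have h := hconv M hI
      have e : ∀ k ∈ range (M + 1), a (k + 2) * a (M + 1 + 1 - k) = a (k + 2) * a (M + 2 - k) :=
        fun k _ => rfl
      rw [sum_congr rfl e]
      have : L ^ M ≤ L ^ (M + 1) := pow_le_pow_right₀ hL1 (Nat.le_succ M)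
      exact h.trans (mul_le_mul_of_nonneg_left this (by positivity))
  -- the `S2`-type sum: endpoints carry `a 1`
  have hS2 : ∀ m : ℕ, (∀ i, 2 ≤ i → i ≤ m + 2 → a i ≤ B * catalan (i - 2) * L ^ (i - 2)) →
      L * ∑ k ∈ range (m + 2), a (k + 1) * a (m + 2 - k)
        ≤ (2 * A₁ + B) * (B * catalan (m + 1) * L ^ (m + 1)) := by
    intro m hI
    rw [sum_range_succ', sum_range_succ]
    have e : ∀ k ∈ range m, a (k + 1 + 1) * a (m + 2 - (k + 1)) = a (k + 2) * a (m + 1 - k) := by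
      intro k hk
      rw [mem_range] at hk
      rw [show m + 2 - (k + 1) = m + 1 - k from by omega]
    rw [sum_congr rfl e, show m + 2 - (m + 1) = 1 from by omega, Nat.zero_add, Nat.sub_zero]
    have h1 := hconv' m (fun i hi hi' => hI i hi (by omega))
    have h2 := hI (m + 2) (by omega) le_rfl
    rw [Nat.add_sub_cancel] at h2
    have hcm : (catalan m : ℝ) ≤ catalan (m + 1) := catalan_mono (Nat.le_succ m)
    have hLm : 0 ≤ L ^ m := pow_nonneg hL0.le m
    have ham : 0 ≤ a (m + 2) := ha _
    -- L * (conv' + a(m+2) a 1 + a 1 a(m+2)) ≤ L * (B² 𝔠_m L^m + 2 A₁ B 𝔠_m L^m)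
    calc L * (∑ k ∈ range m, a (k + 2) * a (m + 1 - k) + a (m + 1 + 1) * a 1 + a (0 + 1) * a (m + 2))
        ≤ L * (B ^ 2 * catalan m * L ^ m + (B * catalan m * L ^ m) * A₁
            + A₁ * (B * catalan m * L ^ m)) := by
          rw [Nat.zero_add]
          gcongr
      _ = (2 * A₁ + B) * (B * catalan m * L ^ (m + 1)) := by ring
      _ ≤ (2 * A₁ + B) * (B * catalan (m + 1) * L ^ (m + 1)) := by gcongr
  -- the `S1`-type sum is the previous `S2`
  have hS1 : ∀ m : ℕ, (∀ i, 2 ≤ i → i ≤ m + 1 → a i ≤ B * catalan (i - 2) * L ^ (i - 2)) →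
      L * ∑ k ∈ range (m + 1), a (k + 1) * a (m + 1 - k)
        ≤ (2 * A₁ + B) * (B * catalan (m + 1) * L ^ (m + 1)) := by
    intro m hI
    rcases m with _ | m
    · simp only [sum_range_one, Nat.zero_add, Nat.sub_zero, catalan_one, Nat.cast_one, mul_one,
        pow_one]
      have h2 := ha 2
      have : A₁ * A₁ ≤ B := by rw [hB]; nlinarith
      rw [← hA₁]
      calc L * (A₁ * A₁) ≤ L * B := by gcongr
        _ ≤ L * ((2 * A₁ + B) * B) := by
            gcongr
            exact le_mul_of_one_le_left hB0 (by linarith)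
        _ = (2 * A₁ + B) * (B * L) := by ring
    · have e : ∀ k ∈ range (m + 1 + 1), a (k + 1) * a (m + 1 + 1 - k) = a (k + 1) * a (m + 2 - k) :=
        fun k _ => rfl
      rw [sum_congr rfl e]
      refine (hS2 m hI).trans ?_
      have : B * catalan (m + 1) * L ^ (m + 1) ≤ B * catalan (m + 1 + 1) * L ^ (m + 1 + 1) :=
        hmono (Nat.le_succ _)
      nlinarith
  -- the inductive step: target index `m + 3`
  have hstep : ∀ m : ℕ, (∀ i, 2 ≤ i → i ≤ m + 2 → a i ≤ B * catalan (i - 2) * L ^ (i - 2)) →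
      a (m + 3) ≤ B * catalan (m + 1) * L ^ (m + 1) := by
    intro m hI
    have h := hrec (m + 1)
    set T : ℝ := B * catalan (m + 1) * L ^ (m + 1) with hT
    have hT0 : 0 ≤ T := by positivity
    -- (1) the linear term
    have h1 : L * a (m + 2) ≤ T := by
      have := hI (m + 2) (by omega) le_rfl
      rw [Nat.add_sub_cancel] at this
      calc L * a (m + 2) ≤ L * (B * catalan m * L ^ m) := by gcongr
        _ = B * catalan m * L ^ (m + 1) := by ring
        _ ≤ T := by rw [hT]; gcongr; exact_mod_cast catalan_mono (Nat.le_succ m)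
    -- (2) S1, (3) S2
    have h2 := hS1 m (fun i hi hi' => hI i hi (by omega))
    have h3 := hS2 m hI
    -- (4) S3
    have h4 : L * ∑ k ∈ range (m + 1), a (k + 2) * a (m + 1 + 1 - k) ≤ B * T := by
      have := hconv m hI
      calc L * ∑ k ∈ range (m + 1), a (k + 2) * a (m + 1 + 1 - k)
          = L * ∑ k ∈ range (m + 1), a (k + 2) * a (m + 2 - k) := rfl
        _ ≤ L * (B ^ 2 * catalan (m + 1) * L ^ m) := by gcongr
        _ = B * T := by rw [hT]; ring
    -- assemble
    have hsum : L * (a (m + 1 + 1) + ∑ k ∈ range (m + 1), a (k + 1) * a (m + 1 - k)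
        + ∑ k ∈ range (m + 1 + 1), a (k + 1) * a (m + 1 + 1 - k)
        + ∑ k ∈ range (m + 1), a (k + 2) * a (m + 1 + 1 - k)) ≤ (1 + 4 * A₁ + 3 * B) * T := by
      have e3 : L * ∑ k ∈ range (m + 1 + 1), a (k + 1) * a (m + 1 + 1 - k) ≤ (2 * A₁ + B) * T := h3
      have e1 : L * a (m + 1 + 1) ≤ T := h1
      nlinarith
    have hfin : L * a (m + 1 + 2) ≤ L * T := by
      calc L * a (m + 1 + 2) ≤ L * (Q * (a (m + 1 + 1)
            + ∑ k ∈ range (m + 1), a (k + 1) * a (m + 1 - k)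
            + ∑ k ∈ range (m + 1 + 1), a (k + 1) * a (m + 1 + 1 - k)
            + ∑ k ∈ range (m + 1), a (k + 2) * a (m + 1 + 1 - k))) := by gcongr
        _ = Q * (L * (a (m + 1 + 1)
            + ∑ k ∈ range (m + 1), a (k + 1) * a (m + 1 - k)
            + ∑ k ∈ range (m + 1 + 1), a (k + 1) * a (m + 1 + 1 - k)
            + ∑ k ∈ range (m + 1), a (k + 2) * a (m + 1 + 1 - k))) := by ring
        _ ≤ Q * ((1 + 4 * A₁ + 3 * B) * T) := by gcongr
        _ ≤ L * T := by
            rw [hL]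
            nlinarith
    exact le_of_mul_le_mul_left hfin hL0
  -- strong induction
  suffices H : ∀ N i : ℕ, 2 ≤ i → i ≤ N + 2 → a i ≤ B * catalan (i - 2) * L ^ (i - 2) from
    fun m hm => H m m hm (by omega)
  intro N
  induction N with
  | zero =>
    intro i hi hi'
    obtain rfl : i = 2 := le_antisymm hi' hi
    simp only [Nat.sub_self, catalan_zero, Nat.cast_one, mul_one, pow_zero]
    rw [hB]; nlinarith [ha 2]
  | succ N ih =>
    intro i hi hi'
    by_cases h : i ≤ N + 2
    · exact ih i hi h
    · obtain rfl : i = N + 3 := by omega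
      exact hstep N ih

/-- Existential form of `catalan_majorant`. [cite: BuckmasterCaolaboraGomezserrano2025, proof of Prop. 2.3] -/
theorem exists_catalan_majorant {a : ℕ → ℝ} (ha : ∀ n, 0 ≤ a n) {Q : ℝ} (hQ : 0 ≤ Q)
    (hrec : ∀ n : ℕ, a (n + 2) ≤ Q * (a (n + 1)
      + ∑ k ∈ range n, a (k + 1) * a (n - k)
      + ∑ k ∈ range (n + 1), a (k + 1) * a (n + 1 - k)
      + ∑ k ∈ range n, a (k + 2) * a (n + 1 - k))) :
    ∃ B L : ℝ, 1 ≤ B ∧ 1 ≤ L ∧ ∀ m : ℕ, 2 ≤ m → a m ≤ B * catalan (m - 2) * L ^ (m - 2) := by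
  refine ⟨1 + a 2 + a 1 ^ 2, 1 + Q * (1 + 4 * a 1 + 3 * (1 + a 2 + a 1 ^ 2)), ?_, ?_,
    catalan_majorant ha hQ hrec⟩
  · nlinarith [ha 2, sq_nonneg (a 1)]
  · have := ha 1; have := ha 2; nlinarith [sq_nonneg (a 1)]

/-- From the Catalan majorant to a geometric bound on all of `ℕ`, with explicit constants
`K = B + a₀ + a₁`, `M = 4L`. [folklore] -/
theorem geom_of_catalan {a : ℕ → ℝ} (ha : ∀ n, 0 ≤ a n) {B L : ℝ} (hB : 1 ≤ B) (hL : 1 ≤ L)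
    (h : ∀ m : ℕ, 2 ≤ m → a m ≤ B * catalan (m - 2) * L ^ (m - 2)) :
    ∀ n, a n ≤ (B + a 0 + a 1) * (4 * L) ^ n := by
  intro n
  have hM1 : 1 ≤ 4 * L := by linarith
  have hMn : 1 ≤ (4 * L) ^ n := one_le_pow₀ hM1
  rcases Nat.lt_or_ge n 2 with hn | hn
  · have hn1 : n ≤ 1 := by omega
    rcases Nat.le_one_iff_eq_zero_or_eq_one.mp hn1 with rfl | rfl
    · simp; linarith [ha 1]
    · calc a 1 ≤ B + a 0 + a 1 := by linarith [ha 0]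
        _ ≤ (B + a 0 + a 1) * (4 * L) ^ 1 := le_mul_of_one_le_right (by linarith [ha 0, ha 1]) hMn
  · calc a n ≤ B * catalan (n - 2) * L ^ (n - 2) := h n hn
      _ ≤ B * 4 ^ (n - 2) * L ^ (n - 2) := by
          gcongr
          -- `𝔠ₘ ≤ 4ᵐ` from `(m+1) 𝔠ₘ = C(2m, m) ≤ 4ᵐ`
          have h1 : catalan (n - 2) ≤ (n - 2 + 1) * catalan (n - 2) :=
            Nat.le_mul_of_pos_left _ (Nat.succ_pos _)
          rw [succ_mul_catalan_eq_centralBinom] at h1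
          exact_mod_cast h1.trans (Nat.centralBinom_le_four_pow (n - 2))
      _ = B * (4 * L) ^ (n - 2) := by rw [mul_pow]; ring
      _ ≤ B * (4 * L) ^ n := by
          gcongr
          exact Nat.sub_le n 2
      _ ≤ (B + a 0 + a 1) * (4 * L) ^ n := by
          gcongr
          linarith [ha 0, ha 1]

/-- Existential form of `geom_of_catalan`. [folklore] -/
theorem exists_geom_of_catalan {a : ℕ → ℝ} (ha : ∀ n, 0 ≤ a n) {B L : ℝ} (hB : 1 ≤ B) (hL : 1 ≤ L)
    (h : ∀ m : ℕ, 2 ≤ m → a m ≤ B * catalan (m - 2) * L ^ (m - 2)) :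
    ∃ K M : ℝ, 0 < K ∧ 0 < M ∧ ∀ n, a n ≤ K * M ^ n :=
  ⟨B + a 0 + a 1, 4 * L, by linarith [ha 0, ha 1], by linarith, geom_of_catalan ha hB hL h⟩

/-! ### The coefficient inequality for `aₙ = |wₙ| + |zₙ|` -/

/-- `aₙ := |wₙ| + |zₙ|`. [cite: BuckmasterCaolaboraGomezserrano2025, proof of Prop. 2.3] -/
def av (r : ℝ) (n : ℕ) : ℝ := |w r n| + |z r n|

/-- [folklore] -/
theorem av_nonneg (n : ℕ) : 0 ≤ av r n := by unfold av; positivity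

/-- [folklore] -/
theorem abs_w_le_av (n : ℕ) : |w r n| ≤ av r n := by
  unfold av; linarith [abs_nonneg (z r n)]

/-- [folklore] -/
theorem abs_z_le_av (n : ℕ) : |z r n| ≤ av r n := by
  unfold av; linarith [abs_nonneg (w r n)]

/-- `S₁(n) = Σ_{k<n} a_{k+1} a_{n−k}` (index sum `n + 1`). [folklore] -/
def S1 (r : ℝ) (n : ℕ) : ℝ := ∑ k ∈ range n, av r (k + 1) * av r (n - k)

/-- `S₂(n) = Σ_{k≤n} a_{k+1} a_{n+1−k}` (index sum `n + 2`). [folklore] -/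
def S2 (r : ℝ) (n : ℕ) : ℝ := ∑ k ∈ range (n + 1), av r (k + 1) * av r (n + 1 - k)

/-- `S₃(n) = Σ_{k<n} a_{k+2} a_{n+1−k}` (index sum `n + 3`). [folklore] -/
def S3 (r : ℝ) (n : ℕ) : ℝ := ∑ k ∈ range n, av r (k + 2) * av r (n + 1 - k)

/-- [folklore] -/
theorem S1_nonneg (n : ℕ) : 0 ≤ S1 r n :=
  sum_nonneg fun _ _ => mul_nonneg (av_nonneg _) (av_nonneg _)

/-- [folklore] -/
theorem S2_nonneg (n : ℕ) : 0 ≤ S2 r n :=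
  sum_nonneg fun _ _ => mul_nonneg (av_nonneg _) (av_nonneg _)

/-- [folklore] -/
theorem S3_nonneg (n : ℕ) : 0 ≤ S3 r n :=
  sum_nonneg fun _ _ => mul_nonneg (av_nonneg _) (av_nonneg _)

/-- A Cauchy coefficient of order `n + 1` against `a`: the two extreme terms carry `a₀`. [folklore] -/
theorem abs_cauchy_succ_le {f g : ℕ → ℝ} (hf : ∀ i, |f i| ≤ av r i) (hg : ∀ i, |g i| ≤ av r i)
    (n : ℕ) : |cauchy f g (n + 1)| ≤ 2 * (av r 0 * av r (n + 1)) + S1 r n := by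
  unfold cauchy S1
  calc |∑ k ∈ range (n + 1 + 1), f k * g (n + 1 - k)|
      ≤ ∑ k ∈ range (n + 1 + 1), |f k * g (n + 1 - k)| := abs_sum_le_sum_abs _ _
    _ ≤ ∑ k ∈ range (n + 1 + 1), av r k * av r (n + 1 - k) :=
        sum_le_sum fun k _ => by
          rw [abs_mul]
          exact mul_le_mul (hf k) (hg _) (abs_nonneg _) ((abs_nonneg _).trans (hf k))
    _ = 2 * (av r 0 * av r (n + 1)) + ∑ k ∈ range n, av r (k + 1) * av r (n - k) := by
        rw [sum_range_succ, sum_range_succ']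
        have e : ∀ k ∈ range n, av r (k + 1) * av r (n + 1 - (k + 1))
            = av r (k + 1) * av r (n - k) := by
          intro k _
          rw [show n + 1 - (k + 1) = n - k from by omega]
        rw [sum_congr rfl e, Nat.sub_zero, Nat.sub_self]
        ring

/-- `|D_{W,k+1}| ≤ a_{k+1}`. [folklore] -/
theorem abs_dWc_succ_le (k : ℕ) : |dWc (w r) (z r) (k + 1)| ≤ av r (k + 1) := by
  rw [dWc_succ, abs_div, abs_of_pos (by norm_num : (0:ℝ) < 3),
    div_le_iff₀ (by norm_num : (0:ℝ) < 3)]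
  have h := abs_add_le (2 * w r (k + 1)) (z r (k + 1))
  rw [abs_mul, abs_two] at h
  have := abs_nonneg (w r (k + 1))
  have := abs_nonneg (z r (k + 1))
  unfold av
  linarith

/-- `|D_{Z,k+2}| ≤ a_{k+2}`. [folklore] -/
theorem abs_dZc_two_le (k : ℕ) : |dZc (w r) (z r) (k + 2)| ≤ av r (k + 2) := by
  rw [dZc_succ, abs_div, abs_of_pos (by norm_num : (0:ℝ) < 3),
    div_le_iff₀ (by norm_num : (0:ℝ) < 3)]
  have h := abs_add_le (w r (k + 2)) (2 * z r (k + 2))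
  rw [abs_mul, abs_two] at h
  have := abs_nonneg (w r (k + 2))
  have := abs_nonneg (z r (k + 2))
  unfold av
  linarith

/-- `|D_{Z,k+1}| ≤ a_{k+1}`. [folklore] -/
theorem abs_dZc_two_le' (k : ℕ) : |dZc (w r) (z r) (k + 1)| ≤ av r (k + 1) := by
  rw [dZc_succ, abs_div, abs_of_pos (by norm_num : (0:ℝ) < 3),
    div_le_iff₀ (by norm_num : (0:ℝ) < 3)]
  have h := abs_add_le (w r (k + 1)) (2 * z r (k + 1))
  rw [abs_mul, abs_two] at h
  have := abs_nonneg (w r (k + 1))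
  have := abs_nonneg (z r (k + 1))
  unfold av
  linarith

/-- `|D_{W,0}| ≤ 1 + a₀`, `|D_{Z,0}| ≤ 1 + a₀`. [folklore] -/
theorem abs_dc_zero_le : |dWc (w r) (z r) 0| ≤ 1 + av r 0 ∧ |dZc (w r) (z r) 0| ≤ 1 + av r 0 := by
  have h1 := abs_add_le (2 * w r 0) (z r 0)
  have h2 := abs_add_le (w r 0) (2 * z r 0)
  rw [abs_mul, abs_two] at h1 h2
  have := abs_nonneg (w r 0)
  have := abs_nonneg (z r 0)
  have e1 := abs_add_le (1 : ℝ) ((2 * w r 0 + z r 0) / 3)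
  have e2 := abs_add_le (1 : ℝ) ((w r 0 + 2 * z r 0) / 3)
  rw [abs_one, abs_div, abs_of_pos (by norm_num : (0:ℝ) < 3)] at e1 e2
  unfold av
  constructor
  · simp only [dWc, if_true]
    linarith
  · simp only [dZc, if_true]
    linarith

/-- Bound for the numerator of `w_{n+2}` (eq. (2.9)). [cite: BuckmasterCaolaboraGomezserrano2025, proof of Prop. 2.3] -/
theorem abs_restW_succ_le (n : ℕ) :
    |restW r (w r) (z r) (n + 1)| ≤ ((n : ℝ) + 2) * S2 r n + |r| * av r (n + 1)
      + 4 / 3 * (2 * (av r 0 * av r (n + 1)) + S1 r n) := by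
  have hw : ∀ i, |w r i| ≤ av r i := abs_w_le_av
  have hz : ∀ i, |z r i| ≤ av r i := abs_z_le_av
  -- the `D_W W′` part
  have h1 : |∑ k ∈ range (n + 1), dWc (w r) (z r) (k + 1) * (((n + 1 - (k + 1) : ℕ) : ℝ) + 1)
      * w r (n + 1 - (k + 1) + 1)| ≤ ((n : ℝ) + 2) * S2 r n := by
    unfold S2
    rw [mul_sum]
    refine (abs_sum_le_sum_abs _ _).trans (sum_le_sum fun k hk => ?_)
    rw [mem_range] at hk
    rw [show n + 1 - (k + 1) + 1 = n + 1 - k from by omega,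
      show n + 1 - (k + 1) = n - k from by omega, abs_mul, abs_mul]
    have hwt : |(((n - k : ℕ) : ℝ) + 1)| ≤ (n : ℝ) + 2 := by
      rw [abs_of_nonneg (by positivity)]
      have : ((n - k : ℕ) : ℝ) ≤ n := by exact_mod_cast Nat.sub_le n k
      linarith
    have ha := av_nonneg (r := r) (k + 1)
    calc |dWc (w r) (z r) (k + 1)| * |(((n - k : ℕ) : ℝ) + 1)| * |w r (n + 1 - k)|
        ≤ av r (k + 1) * ((n : ℝ) + 2) * av r (n + 1 - k) :=
          mul_le_mul (mul_le_mul (abs_dWc_succ_le k) hwt (abs_nonneg _) ha) (hw _)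
            (abs_nonneg _) (by positivity)
      _ = ((n : ℝ) + 2) * (av r (k + 1) * av r (n + 1 - k)) := by ring
  -- the `N_W` part
  have h2 : |nWc r (w r) (z r) (n + 1)| ≤ |r| * av r (n + 1)
      + 4 / 3 * (2 * (av r 0 * av r (n + 1)) + S1 r n) := by
    have c1 := abs_cauchy_succ_le (r := r) hw hw n
    have c2 := abs_cauchy_succ_le (r := r) hw hz n
    have c3 := abs_cauchy_succ_le (r := r) hz hz n
    have h5 : |r| * |w r (n + 1)| ≤ |r| * av r (n + 1) :=
      mul_le_mul_of_nonneg_left (hw _) (abs_nonneg r)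
    unfold nWc
    refine le_trans (abs_add_le _ _) ?_
    refine le_trans (add_le_add (abs_sub (_ : ℝ) _) le_rfl) ?_
    refine le_trans (add_le_add (add_le_add (abs_sub (_ : ℝ) _) le_rfl) le_rfl) ?_
    rw [abs_mul, abs_neg, abs_mul, abs_mul, abs_mul, abs_of_pos (by norm_num : (0:ℝ) < 5 / 6),
      abs_of_pos (by norm_num : (0:ℝ) < 1 / 3), abs_of_pos (by norm_num : (0:ℝ) < 1 / 6)]
    linarith
  unfold restW
  refine (abs_sub _ _).trans ?_
  linarith

/-- **Bound for `w_{n+2}`** (from (2.9), `D_W(P_s) > 0`). [cite: BuckmasterCaolaboraGomezserrano2025, proof of Prop. 2.3] -/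
theorem abs_w_succ_succ_le (hr : r < 2) (n : ℕ) :
    |w r (n + 2)| ≤ (S2 r n + (|r| + 8 / 3 * av r 0) * av r (n + 1) + 4 / 3 * S1 r n)
      / DW (W0 r) (Z0 r) := by
  have hD := DW_Ps_pos hr
  have hR := abs_restW_succ_le (r := r) n
  have hS1 := S1_nonneg (r := r) n
  have hS2 := S2_nonneg (r := r) n
  have hav := av_nonneg (r := r) (n + 1)
  have hav0 := av_nonneg (r := r) 0
  have hn : (((n + 1 : ℕ) : ℝ) + 1) = (n : ℝ) + 2 := by push_cast; ring
  have hn2 : (1 : ℝ) ≤ (n : ℝ) + 2 := by linarith [(Nat.cast_nonneg n : (0 : ℝ) ≤ n)]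
  rw [w_succ_succ]
  unfold nextW
  rw [dWc_zero, hn, abs_div, abs_neg,
    abs_of_pos (by positivity : 0 < DW (W0 r) (Z0 r) * ((n : ℝ) + 2)),
    div_le_div_iff₀ (by positivity) hD]
  calc |restW r (w r) (z r) (n + 1)| * DW (W0 r) (Z0 r)
      ≤ (((n : ℝ) + 2) * S2 r n + |r| * av r (n + 1)
          + 4 / 3 * (2 * (av r 0 * av r (n + 1)) + S1 r n)) * DW (W0 r) (Z0 r) :=
        mul_le_mul_of_nonneg_right hR hD.le
    _ ≤ (((n : ℝ) + 2) * S2 r n + ((n : ℝ) + 2) * (|r| * av r (n + 1))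
          + ((n : ℝ) + 2) * (4 / 3 * (2 * (av r 0 * av r (n + 1)) + S1 r n)))
          * DW (W0 r) (Z0 r) := by
        refine mul_le_mul_of_nonneg_right (add_le_add (add_le_add le_rfl ?_) ?_) hD.le
        · exact le_mul_of_one_le_left (by positivity) hn2
        · exact le_mul_of_one_le_left (by positivity) hn2
    _ = (S2 r n + (|r| + 8 / 3 * av r 0) * av r (n + 1) + 4 / 3 * S1 r n)
          * (DW (W0 r) (Z0 r) * ((n : ℝ) + 2)) := by ring

/-- Bound for the known part of the `Z`-recursion (eq. (2.10)). [cite: BuckmasterCaolaboraGomezserrano2025, proof of Prop. 2.3] -/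
theorem abs_restZ_le (n : ℕ) :
    |restZ (w r) (z r) n| ≤ ((n : ℝ) + 1) * S3 r n + 4 / 3 * S2 r n := by
  have hw : ∀ i, |w r i| ≤ av r i := abs_w_le_av
  have hz : ∀ i, |z r i| ≤ av r i := abs_z_le_av
  have h1 : |∑ k ∈ range n, dZc (w r) (z r) (k + 2) * (((n - k : ℕ) : ℝ) + 1) * z r (n - k + 1)|
      ≤ ((n : ℝ) + 1) * S3 r n := by
    unfold S3
    rw [mul_sum]
    refine (abs_sum_le_sum_abs _ _).trans (sum_le_sum fun k hk => ?_)
    rw [mem_range] at hk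
    rw [show n - k + 1 = n + 1 - k from by omega, abs_mul, abs_mul]
    have hwt : |(((n - k : ℕ) : ℝ) + 1)| ≤ (n : ℝ) + 1 := by
      rw [abs_of_nonneg (by positivity)]
      have : ((n - k : ℕ) : ℝ) ≤ n := by exact_mod_cast Nat.sub_le n k
      linarith
    have ha := av_nonneg (r := r) (k + 2)
    calc |dZc (w r) (z r) (k + 2)| * |(((n - k : ℕ) : ℝ) + 1)| * |z r (n + 1 - k)|
        ≤ av r (k + 2) * ((n : ℝ) + 1) * av r (n + 1 - k) :=
          mul_le_mul (mul_le_mul (abs_dZc_two_le k) hwt (abs_nonneg _) ha) (hz _)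
            (abs_nonneg _) (by positivity)
      _ = ((n : ℝ) + 1) * (av r (k + 2) * av r (n + 1 - k)) := by ring
  have hprod : ∀ {f g : ℕ → ℝ}, (∀ i, |f i| ≤ av r i) → (∀ i, |g i| ≤ av r i) →
      |∑ k ∈ range (n + 1), f (k + 1) * g (n + 1 - k)| ≤ S2 r n := fun hf hg =>
    (abs_sum_le_sum_abs _ _).trans (sum_le_sum fun k _ => by
      rw [abs_mul]
      exact mul_le_mul (hf _) (hg _) (abs_nonneg _) ((abs_nonneg _).trans (hf _)))
  have c1 := hprod hw hz
  have c2 := hprod hz hz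
  have c3 := hprod hw hw
  unfold restZ
  refine le_trans (abs_sub _ _) ?_
  refine le_trans (add_le_add (abs_add_le (_ : ℝ) _) le_rfl) ?_
  refine le_trans (add_le_add (add_le_add (abs_add_le (_ : ℝ) _) le_rfl) le_rfl) ?_
  rw [abs_mul, abs_mul, abs_mul, abs_of_pos (by norm_num : (0:ℝ) < 1 / 3),
    abs_of_pos (by norm_num : (0:ℝ) < 5 / 6), abs_of_pos (by norm_num : (0:ℝ) < 1 / 6)]
  linarith

/-- The explicit constant `K(r) = max(4/D_{Z,1}, 1/|s₂|, 2/|s₃|, 3/|s₄|)`, `sₘ = slopeZ(m)`, of the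
slope bound. [cite: BuckmasterCaolaboraGomezserrano2025, proof of Prop. 2.3] -/
def slopeK (r : ℝ) : ℝ :=
  max (4 / (2 - r - p r)) (max (1 / |slopeZ r (w r) (z r) 2|)
    (max (2 / |slopeZ r (w r) (z r) 3|) (3 / |slopeZ r (w r) (z r) 4|)))

/-- [folklore] -/
theorem slopeK_nonneg (hr : r < rstar) : 0 ≤ slopeK r := by
  unfold slopeK
  have := DZ1_pos hr
  exact le_trans (by positivity) (le_max_left _ _)

/-- The denominators `D_{Z,1}(n + 2 − k)` of (2.10) dominate the weights `n + 1`: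
`n + 1 ≤ K(r) |slopeZ(n+2)|` for all `n` (uses `3 < k < 4` on `(r₃, r₄)`).
[cite: BuckmasterCaolaboraGomezserrano2025, proof of Prop. 2.3] -/
theorem slope_bound (h3 : r3 < r) (h4 : r < r4) (n : ℕ) :
    (n : ℝ) + 1 ≤ slopeK r * |slopeZ r (w r) (z r) (n + 2)| := by
  have hm := r3_r4_mem
  have hr : r < rstar := h4.trans hm.2.2
  have hD := DZ1_pos hr
  have hk := k_mem_Ioo h3 h4
  have hs : ∀ m : ℕ, slopeZ r (w r) (z r) m = (2 - r - p r) * ((m : ℝ) - k r) :=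
    slopeZ_eq hD.ne'
  have hne := slopeZ_ne h3 h4
  have hspos : ∀ m, 0 < |slopeZ r (w r) (z r) m| := fun m => abs_pos.mpr (hne m)
  have hs2 := hspos 2
  have hs3 := hspos 3
  have hs4 := hspos 4
  set Kc : ℝ := max (4 / (2 - r - p r)) (max (1 / |slopeZ r (w r) (z r) 2|)
    (max (2 / |slopeZ r (w r) (z r) 3|) (3 / |slopeZ r (w r) (z r) 4|))) with hKc
  show (n : ℝ) + 1 ≤ Kc * |slopeZ r (w r) (z r) (n + 2)|
  have hK1 : 1 / |slopeZ r (w r) (z r) 2| ≤ Kc := (le_max_left _ _).trans (le_max_right _ _)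
  have hK2 : 2 / |slopeZ r (w r) (z r) 3| ≤ Kc :=
    ((le_max_left _ _).trans (le_max_right _ _)).trans (le_max_right _ _)
  have hK3 : 3 / |slopeZ r (w r) (z r) 4| ≤ Kc :=
    (((le_max_right _ _).trans (le_max_right _ _)).trans (le_max_right _ _))
  have hK4 : 4 / (2 - r - p r) ≤ Kc := le_max_left _ _
  rcases Nat.lt_or_ge n 3 with hn | hn
  · interval_cases n
    · rw [div_le_iff₀ hs2] at hK1
      norm_num
      linarith
    · rw [div_le_iff₀ hs3] at hK2
      norm_num
      linarith
    · rw [div_le_iff₀ hs4] at hK3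
      norm_num
      linarith
  · have hn' : (3 : ℝ) ≤ n := by exact_mod_cast hn
    have hpos : 0 < (2 - r - p r) * ((((n + 2 : ℕ)) : ℝ) - k r) := by
      refine mul_pos hD ?_
      push_cast
      linarith [hk.2]
    have hsn : |slopeZ r (w r) (z r) (n + 2)| = (2 - r - p r) * ((((n + 2 : ℕ)) : ℝ) - k r) := by
      rw [hs, abs_of_pos hpos]
    have e : 4 / (2 - r - p r) * ((2 - r - p r) * ((((n + 2 : ℕ)) : ℝ) - k r))
        = 4 * ((n : ℝ) + 2 - k r) := by
      push_cast
      field_simp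
    calc (n : ℝ) + 1 ≤ 4 * ((n : ℝ) + 2 - k r) := by linarith [hk.2]
      _ = 4 / (2 - r - p r) * |slopeZ r (w r) (z r) (n + 2)| := by rw [hsn, e]
      _ ≤ Kc * |slopeZ r (w r) (z r) (n + 2)| := mul_le_mul_of_nonneg_right hK4 (hspos _).le

/-- Existential form of `slope_bound`. [cite: BuckmasterCaolaboraGomezserrano2025, proof of Prop. 2.3] -/
theorem exists_slope_bound (h3 : r3 < r) (h4 : r < r4) :
    ∃ K : ℝ, 0 ≤ K ∧ ∀ n : ℕ, (n : ℝ) + 1 ≤ K * |slopeZ r (w r) (z r) (n + 2)| :=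
  ⟨slopeK r, slopeK_nonneg (h4.trans r3_r4_mem.2.2), slope_bound h3 h4⟩

/-- **Bound for `z_{n+2}`** (from (2.10)). [cite: BuckmasterCaolaboraGomezserrano2025, proof of Prop. 2.3] -/
theorem abs_z_succ_succ_le (h3 : r3 < r) (h4 : r < r4) {K : ℝ}
    (hK : ∀ n : ℕ, (n : ℝ) + 1 ≤ K * |slopeZ r (w r) (z r) (n + 2)|) (n : ℕ) :
    |z r (n + 2)| ≤ K * (|coefW (w r) (z r)| * |w r (n + 2)| + S3 r n + 4 / 3 * S2 r n) := by
  have hne := slopeZ_ne h3 h4 (n + 2)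
  have hs := abs_pos.mpr hne
  have hR := abs_restZ_le (r := r) n
  have hS2 := S2_nonneg (r := r) n
  have hS3 := S3_nonneg (r := r) n
  have hcw : 0 ≤ |coefW (w r) (z r)| * |w r (n + 2)| := by positivity
  have hn1 : (1 : ℝ) ≤ (n : ℝ) + 1 := by linarith [(Nat.cast_nonneg n : (0 : ℝ) ≤ n)]
  rw [z_succ_succ]
  unfold nextZ
  rw [abs_div, abs_neg, div_le_iff₀ hs]
  calc |coefW (w r) (z r) * w r (n + 2) + restZ (w r) (z r) n|
      ≤ |coefW (w r) (z r)| * |w r (n + 2)| + (((n : ℝ) + 1) * S3 r n + 4 / 3 * S2 r n) :=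
        (abs_add_le _ _).trans (add_le_add (le_of_eq (abs_mul _ _)) hR)
    _ ≤ ((n : ℝ) + 1) * (|coefW (w r) (z r)| * |w r (n + 2)| + S3 r n + 4 / 3 * S2 r n) := by
        nlinarith
    _ ≤ K * |slopeZ r (w r) (z r) (n + 2)|
          * (|coefW (w r) (z r)| * |w r (n + 2)| + S3 r n + 4 / 3 * S2 r n) :=
        mul_le_mul_of_nonneg_right (hK n) (by positivity)
    _ = K * (|coefW (w r) (z r)| * |w r (n + 2)| + S3 r n + 4 / 3 * S2 r n)
          * |slopeZ r (w r) (z r) (n + 2)| := by ring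

/-- The explicit constant `Q(r)` of the coefficient inequality.
[cite: BuckmasterCaolaboraGomezserrano2025, proof of Prop. 2.3] -/
def recQ (r : ℝ) : ℝ :=
  (1 + slopeK r * |coefW (w r) (z r)|) / DW (W0 r) (Z0 r) * (3 + (|r| + 8 / 3 * av r 0))
    + 3 * slopeK r

/-- [folklore] -/
theorem recQ_nonneg (hr : r < rstar) : 0 ≤ recQ r := by
  unfold recQ
  have hK := slopeK_nonneg hr
  have hD := DW_Ps_pos (show r < 2 by linarith [rstar_lt])
  have := av_nonneg (r := r) 0
  positivity

/-- **The coefficient inequality** feeding the abstract majorant lemma, with the explicit constant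
`Q(r)`. [cite: BuckmasterCaolaboraGomezserrano2025, proof of Prop. 2.3] -/
theorem av_rec' (h3 : r3 < r) (h4 : r < r4) (n : ℕ) :
    av r (n + 2) ≤ recQ r * (av r (n + 1) + S1 r n + S2 r n + S3 r n) := by
  have hm := r3_r4_mem
  have hr : r < rstar := h4.trans hm.2.2
  have hr2 : r < 2 := by linarith [rstar_lt]
  have hK0 := slopeK_nonneg hr
  have hK := slope_bound h3 h4
  set K := slopeK r with hKdef
  have hD := DW_Ps_pos hr2
  have hav00 := av_nonneg (r := r) 0
  have hcW0 : 0 ≤ |coefW (w r) (z r)| := abs_nonneg _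
  have hc0 : 0 ≤ |r| + 8 / 3 * av r 0 := by positivity
  have hE0 : 0 ≤ (1 + K * |coefW (w r) (z r)|) / DW (W0 r) (Z0 r) := by positivity
  show av r (n + 2) ≤ ((1 + K * |coefW (w r) (z r)|) / DW (W0 r) (Z0 r) * (3 + (|r| + 8 / 3 * av r 0))
    + 3 * K) * (av r (n + 1) + S1 r n + S2 r n + S3 r n)
  set D := DW (W0 r) (Z0 r) with hDdef
  set cW := |coefW (w r) (z r)| with hcWdef
  set c := |r| + 8 / 3 * av r 0 with hcdef
  set E := (1 + K * cW) / D with hEdef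
  have hw := abs_w_succ_succ_le (r := r) hr2 n
  have hz := abs_z_succ_succ_le h3 h4 hK n
  have hS1 := S1_nonneg (r := r) n
  have hS2 := S2_nonneg (r := r) n
  have hS3 := S3_nonneg (r := r) n
  have hav := av_nonneg (r := r) (n + 1)
  have hwabs : 0 ≤ |w r (n + 2)| := abs_nonneg _
  have h1 : av r (n + 2) ≤ (1 + K * cW) * |w r (n + 2)| + K * S3 r n + 4 / 3 * K * S2 r n := by
    unfold av
    linarith
  have h2 : (1 + K * cW) * |w r (n + 2)| ≤ E * (S2 r n + c * av r (n + 1) + 4 / 3 * S1 r n) := by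
    have := mul_le_mul_of_nonneg_left hw (by positivity : 0 ≤ 1 + K * cW)
    rw [hEdef]
    calc (1 + K * cW) * |w r (n + 2)|
        ≤ (1 + K * cW) * ((S2 r n + (|r| + 8 / 3 * av r 0) * av r (n + 1) + 4 / 3 * S1 r n) / D) :=
          this
      _ = (1 + K * cW) / D * (S2 r n + c * av r (n + 1) + 4 / 3 * S1 r n) := by
          rw [hcdef]; ring
  nlinarith [mul_nonneg hE0 hav, mul_nonneg hE0 hS1, mul_nonneg hE0 hS2, mul_nonneg hE0 hS3,
    mul_nonneg (mul_nonneg hE0 hc0) hav, mul_nonneg (mul_nonneg hE0 hc0) hS1,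
    mul_nonneg (mul_nonneg hE0 hc0) hS2, mul_nonneg (mul_nonneg hE0 hc0) hS3,
    mul_nonneg hK0 hav, mul_nonneg hK0 hS1, mul_nonneg hK0 hS2, mul_nonneg hK0 hS3]

/-- Existential form of `av_rec'`. [cite: BuckmasterCaolaboraGomezserrano2025, proof of Prop. 2.3] -/
theorem av_rec (h3 : r3 < r) (h4 : r < r4) : ∃ Q : ℝ, 0 ≤ Q ∧ ∀ n : ℕ,
    av r (n + 2) ≤ Q * (av r (n + 1) + S1 r n + S2 r n + S3 r n) :=
  ⟨recQ r, recQ_nonneg (h4.trans r3_r4_mem.2.2), av_rec' h3 h4⟩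

/-- The explicit constants of the geometric bound: `aₙ ≤ geoK(r) geoM(r)ⁿ` with
`geoK = (1 + a₂ + a₁²) + a₀ + a₁`, `geoM = 4(1 + Q(1 + 4a₁ + 3(1 + a₂ + a₁²)))`.
[cite: BuckmasterCaolaboraGomezserrano2025, proof of Prop. 2.3] -/
def geoK (r : ℝ) : ℝ := (1 + av r 2 + av r 1 ^ 2) + av r 0 + av r 1

/-- See `geoK`. [cite: BuckmasterCaolaboraGomezserrano2025, proof of Prop. 2.3] -/
def geoM (r : ℝ) : ℝ := 4 * (1 + recQ r * (1 + 4 * av r 1 + 3 * (1 + av r 2 + av r 1 ^ 2)))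

/-- [folklore] -/
theorem geoK_pos (r : ℝ) : 0 < geoK r := by
  unfold geoK
  have := av_nonneg (r := r) 0; have := av_nonneg (r := r) 1; have := av_nonneg (r := r) 2
  positivity

/-- [folklore] -/
theorem four_le_geoM (hr : r < rstar) : 4 ≤ geoM r := by
  unfold geoM
  have := recQ_nonneg hr
  have := av_nonneg (r := r) 1; have := av_nonneg (r := r) 2
  nlinarith [sq_nonneg (av r 1)]

/-- **Proposition 2.3 at `γ = 5/3` (convergence), explicit form: `|wₙ| + |zₙ| ≤ geoK(r) geoM(r)ⁿ`**
for `r ∈ (r₃, r₄)`. [cite: BuckmasterCaolaboraGomezserrano2025, Prop. 2.3] -/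
theorem av_le_geom (h3 : r3 < r) (h4 : r < r4) (n : ℕ) : av r n ≤ geoK r * geoM r ^ n := by
  have hr : r < rstar := h4.trans r3_r4_mem.2.2
  have hmaj := catalan_majorant (a := av r) av_nonneg (recQ_nonneg hr)
    (fun n => by have h := av_rec' h3 h4 n; unfold S1 S2 S3 at h; exact h)
  have hB : (1 : ℝ) ≤ 1 + av r 2 + av r 1 ^ 2 := by nlinarith [av_nonneg (r := r) 2, sq_nonneg (av r 1)]
  have hL : (1 : ℝ) ≤ 1 + recQ r * (1 + 4 * av r 1 + 3 * (1 + av r 2 + av r 1 ^ 2)) := by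
    have := recQ_nonneg hr
    have := av_nonneg (r := r) 1; have := av_nonneg (r := r) 2
    nlinarith [sq_nonneg (av r 1)]
  have h := geom_of_catalan av_nonneg hB hL hmaj n
  unfold geoK geoM
  exact h

/-- **Proposition 2.3 at `γ = 5/3` (convergence): `|wₙ| + |zₙ| ≤ K Mⁿ`** for `r ∈ (r₃, r₄)`, so
the Taylor series of `(W^{(r)}, Z^{(r)})` at `P_s` have a positive radius of convergence.
[cite: BuckmasterCaolaboraGomezserrano2025, Prop. 2.3] -/
theorem exists_av_le_geom (h3 : r3 < r) (h4 : r < r4) :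
    ∃ K M : ℝ, 0 < K ∧ 0 < M ∧ ∀ n, av r n ≤ K * M ^ n :=
  ⟨geoK r, geoM r, geoK_pos r, by linarith [four_le_geoM (h4.trans r3_r4_mem.2.2)],
    av_le_geom h3 h4⟩

/-! ## Part 3 — summing the series: the analytic solution through `P_s`

With `|wₙ| + |zₙ| ≤ K Mⁿ`, the sums `W(ξ) = Σ wₙ ξⁿ`, `Z(ξ) = Σ zₙ ξⁿ` converge for
`|ξ| < 1/(2M)`, are analytic there, can be differentiated termwise, and — by the coefficient
identities `EW_wz`, `EZfull_wz` and five Cauchy products — solve (1.8):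
`D_W(W,Z) W′ = N_W(W,Z)`, `D_Z(W,Z) Z′ = N_Z(W,Z)`, with `(W,Z)(0) = P_s`, `(W′,Z′)(0) = (W₁,Z₁)`.
[cite: BuckmasterCaolaboraGomezserrano2025, Prop. 2.2, Prop. 2.3]
-/

/-! ### Generic power-series lemmas under a geometric coefficient bound -/

section Generic

variable {f : ℕ → ℝ} {K M : ℝ}

/-- [folklore] -/
theorem half_of_lt (hM : 0 < M) {y : ℝ} (hy : |y| < 1 / (2 * M)) : M * |y| ≤ 1 / 2 := by
  rw [lt_div_iff₀ (by positivity)] at hy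
  linarith

/-- [folklore] -/
theorem nonneg_of_bound (hf : ∀ n, |f n| ≤ K * M ^ n) : 0 ≤ K := by
  have := (abs_nonneg _).trans (hf 0)
  simpa using this

/-- Term bound `|fₙ ξⁿ| ≤ K 2⁻ⁿ`. [folklore] -/
theorem abs_term_le (hf : ∀ n, |f n| ≤ K * M ^ n) (hM : 0 ≤ M) {ξ : ℝ}
    (hξ : M * |ξ| ≤ 1 / 2) (n : ℕ) : |f n * ξ ^ n| ≤ K * (1 / 2) ^ n := by
  have hK := nonneg_of_bound hf
  rw [abs_mul, abs_pow]
  calc |f n| * |ξ| ^ n ≤ K * M ^ n * |ξ| ^ n := by gcongr; exact hf n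
    _ = K * (M * |ξ|) ^ n := by rw [mul_pow]; ring
    _ ≤ K * (1 / 2) ^ n := by gcongr

/-- Term bound for the derivative series `|(n+1) fₙ₊₁ ξⁿ| ≤ K M (n+1) 2⁻ⁿ`. [folklore] -/
theorem abs_deriv_term_le (hf : ∀ n, |f n| ≤ K * M ^ n) (hM : 0 ≤ M) {ξ : ℝ}
    (hξ : M * |ξ| ≤ 1 / 2) (n : ℕ) :
    |((n : ℝ) + 1) * f (n + 1) * ξ ^ n| ≤ K * M * (((n : ℝ) + 1) * (1 / 2) ^ n) := by
  have hK := nonneg_of_bound hf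
  rw [abs_mul, abs_mul, abs_pow, abs_of_nonneg (by positivity : (0:ℝ) ≤ (n : ℝ) + 1)]
  calc ((n : ℝ) + 1) * |f (n + 1)| * |ξ| ^ n
      ≤ ((n : ℝ) + 1) * (K * M ^ (n + 1)) * |ξ| ^ n := by gcongr; exact hf (n + 1)
    _ = K * M * (((n : ℝ) + 1) * (M * |ξ|) ^ n) := by rw [mul_pow]; ring
    _ ≤ K * M * (((n : ℝ) + 1) * (1 / 2) ^ n) := by gcongr

/-- Absolute summability of `Σ fₙ ξⁿ` inside the radius. [folklore] -/
theorem summable_norm_term (hf : ∀ n, |f n| ≤ K * M ^ n) (hM : 0 ≤ M) {ξ : ℝ}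
    (hξ : M * |ξ| ≤ 1 / 2) : Summable fun n => ‖f n * ξ ^ n‖ := by
  refine Summable.of_nonneg_of_le (fun n => norm_nonneg _) (fun n => ?_)
    ((summable_geometric_of_lt_one (by norm_num) (by norm_num) :
      Summable fun n : ℕ => (1 / 2 : ℝ) ^ n).mul_left K)
  rw [Real.norm_eq_abs]
  exact abs_term_le hf hM hξ n

/-- Absolute summability of the derivative series inside the radius. [folklore] -/
theorem summable_norm_deriv_term (hf : ∀ n, |f n| ≤ K * M ^ n) (hM : 0 ≤ M) {ξ : ℝ}
    (hξ : M * |ξ| ≤ 1 / 2) : Summable fun n : ℕ => ‖((n : ℝ) + 1) * f (n + 1) * ξ ^ n‖ := by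
  have hs : Summable fun n : ℕ => ((n : ℝ) + 1) * (1 / 2 : ℝ) ^ n := by
    have h1 : Summable fun n : ℕ => (n : ℝ) ^ 1 * (1 / 2 : ℝ) ^ n :=
      summable_pow_mul_geometric_of_norm_lt_one 1 (by norm_num [abs_of_pos])
    simp only [pow_one] at h1
    refine (h1.add (summable_geometric_of_lt_one (by norm_num) (by norm_num) :
      Summable fun n : ℕ => (1 / 2 : ℝ) ^ n)).congr fun n => ?_
    ring
  refine Summable.of_nonneg_of_le (fun n => norm_nonneg _) (fun n => ?_) (hs.mul_left (K * M))
  rw [Real.norm_eq_abs]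
  exact abs_deriv_term_le hf hM hξ n

/-- `HasSum (fₙ ξⁿ) (Σ' fₙ ξⁿ)` inside the radius. [folklore] -/
theorem hasSum_term (hf : ∀ n, |f n| ≤ K * M ^ n) (hM : 0 ≤ M) {ξ : ℝ}
    (hξ : M * |ξ| ≤ 1 / 2) : HasSum (fun n => f n * ξ ^ n) (∑' n, f n * ξ ^ n) :=
  (summable_norm_term hf hM hξ).of_norm.hasSum

/-- **Termwise differentiation** of `x ↦ Σ fₙ xⁿ` inside the radius `1/(2M)`. [folklore] -/
theorem hasDerivAt_tsum_term (hf : ∀ n, |f n| ≤ K * M ^ n) (hM : 0 < M) {ξ : ℝ}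
    (hξ : |ξ| < 1 / (2 * M)) :
    HasDerivAt (fun x => ∑' n, f n * x ^ n) (∑' n, f n * ((n : ℝ) * ξ ^ (n - 1))) ξ := by
  have hK := nonneg_of_bound hf
  set u : ℕ → ℝ := fun n => K * M * (2 * ((n : ℝ) * (1 / 2) ^ n)) with hu
  have hu_sum : Summable u := by
    have h1 : Summable fun n : ℕ => (n : ℝ) ^ 1 * (1 / 2 : ℝ) ^ n :=
      summable_pow_mul_geometric_of_norm_lt_one 1 (by norm_num [abs_of_pos])
    simp only [pow_one] at h1
    exact (h1.mul_left 2).mul_left (K * M)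
  have hball : ∀ y : ℝ, y ∈ Metric.ball (0 : ℝ) (1 / (2 * M)) → M * |y| ≤ 1 / 2 := fun y hy =>
    half_of_lt hM (by simpa [Real.dist_eq] using hy)
  have hg' : ∀ (n : ℕ) (y : ℝ), y ∈ Metric.ball (0 : ℝ) (1 / (2 * M)) →
      ‖f n * ((n : ℝ) * y ^ (n - 1))‖ ≤ u n := by
    intro n y hy
    have hy' := hball y hy
    rw [Real.norm_eq_abs]
    rcases Nat.eq_zero_or_pos n with rfl | hn
    · simp [hu]
    obtain ⟨m, rfl⟩ : ∃ m, n = m + 1 := ⟨n - 1, by omega⟩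
    simp only [hu, Nat.add_sub_cancel]
    rw [abs_mul, abs_mul, abs_pow, abs_of_nonneg (by positivity : (0:ℝ) ≤ ((m + 1 : ℕ) : ℝ))]
    calc |f (m + 1)| * ((((m + 1 : ℕ)) : ℝ) * |y| ^ m)
        ≤ K * M ^ (m + 1) * ((((m + 1 : ℕ)) : ℝ) * |y| ^ m) := by
          gcongr; exact hf (m + 1)
      _ = K * M * ((((m + 1 : ℕ)) : ℝ) * (M * |y|) ^ m) := by rw [mul_pow]; ring
      _ ≤ K * M * ((((m + 1 : ℕ)) : ℝ) * (1 / 2) ^ m) := by gcongr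
      _ = K * M * (2 * ((((m + 1 : ℕ)) : ℝ) * (1 / 2) ^ (m + 1))) := by ring
  have hg : ∀ (n : ℕ) (y : ℝ), y ∈ Metric.ball (0 : ℝ) (1 / (2 * M)) →
      HasDerivAt (fun x => f n * x ^ n) (f n * ((n : ℝ) * y ^ (n - 1))) y :=
    fun n y _ => (hasDerivAt_pow n y).const_mul (f n)
  have hρ : (0 : ℝ) < 1 / (2 * M) := by positivity
  have h0 : (0 : ℝ) ∈ Metric.ball (0 : ℝ) (1 / (2 * M)) := Metric.mem_ball_self hρ
  have hsum0 : Summable fun n => f n * (0 : ℝ) ^ n :=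
    (summable_norm_term hf hM.le (ξ := 0) (by simp)).of_norm
  have hξ' : ξ ∈ Metric.ball (0 : ℝ) (1 / (2 * M)) := by simpa [Real.dist_eq] using hξ
  exact hasDerivAt_tsum_of_isPreconnected hu_sum Metric.isOpen_ball
    (convex_ball (0 : ℝ) (1 / (2 * M))).isPreconnected hg hg' h0 hsum0 hξ'

/-- `HasSum ((n+1) fₙ₊₁ ξⁿ) ((Σ fₙ xⁿ)′(ξ))` inside the radius. [folklore] -/
theorem hasSum_deriv_term (hf : ∀ n, |f n| ≤ K * M ^ n) (hM : 0 < M) {ξ : ℝ}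
    (hξ : |ξ| < 1 / (2 * M)) :
    HasSum (fun n : ℕ => ((n : ℝ) + 1) * f (n + 1) * ξ ^ n)
      (deriv (fun x => ∑' n, f n * x ^ n) ξ) := by
  rw [(hasDerivAt_tsum_term hf hM hξ).deriv]
  have hξ' := half_of_lt hM hξ
  have hs : Summable fun n => f n * ((n : ℝ) * ξ ^ (n - 1)) := by
    have h1 := (summable_norm_deriv_term hf hM.le hξ').of_norm
    rw [← summable_nat_add_iff 1]
    refine h1.congr fun n => ?_
    simp only [Nat.add_sub_cancel, Nat.cast_succ]
    ring
  have h2 := (hasSum_nat_add_iff' 1).mpr hs.hasSum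
  simp only [sum_range_one, Nat.cast_zero, zero_mul, mul_zero, sub_zero] at h2
  refine h2.congr_fun fun n => ?_
  simp only [Nat.add_sub_cancel, Nat.cast_succ]
  ring

/-- The value at `0` of `Σ fₙ xⁿ` is `f₀`. [folklore] -/
theorem tsum_term_zero (f : ℕ → ℝ) : ∑' n, f n * (0 : ℝ) ^ n = f 0 := by
  rw [tsum_eq_single 0 (fun n hn => by simp [hn])]
  simp

/-- The derivative at `0` of `Σ fₙ xⁿ` is `f₁`. [folklore] -/
theorem deriv_tsum_term_zero (hf : ∀ n, |f n| ≤ K * M ^ n) (hM : 0 < M) :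
    deriv (fun x => ∑' n, f n * x ^ n) 0 = f 1 := by
  have h := hasSum_deriv_term hf hM (ξ := 0) (by rw [abs_zero]; positivity)
  have h2 : HasSum (fun n : ℕ => ((n : ℝ) + 1) * f (n + 1) * (0 : ℝ) ^ n)
      ((((0 : ℕ) : ℝ) + 1) * f (0 + 1) * (0 : ℝ) ^ 0) :=
    hasSum_single 0 (fun n hn => by simp [hn])
  rw [h.unique h2]
  simp

/-- Analyticity of `Σ fₙ xⁿ` inside the radius. [folklore] -/
theorem analyticAt_tsum_term (hf : ∀ n, |f n| ≤ K * M ^ n) (hM : 0 < M) {ξ : ℝ}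
    (hξ : |ξ| < 1 / (2 * M)) : AnalyticAt ℝ (fun x => ∑' n, f n * x ^ n) ξ := by
  have hK := nonneg_of_bound hf
  set p := FormalMultilinearSeries.ofScalars ℝ f with hp
  let Minv : NNReal := ⟨M⁻¹, inv_nonneg.mpr hM.le⟩
  have hrad : ((Minv : NNReal) : ENNReal) ≤ p.radius := by
    refine p.le_radius_of_bound K fun n => ?_
    rw [hp, FormalMultilinearSeries.ofScalars_norm, Real.norm_eq_abs]
    show |f n| * (M⁻¹) ^ n ≤ K
    calc |f n| * (M⁻¹) ^ n ≤ K * M ^ n * (M⁻¹) ^ n := by gcongr; exact hf n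
      _ = K := by rw [mul_assoc, ← mul_pow, mul_inv_cancel₀ hM.ne', one_pow, mul_one]
  have hMinv_pos : (0 : ENNReal) < ((Minv : NNReal) : ENNReal) := by
    have : (0 : NNReal) < Minv := by
      show (0 : ℝ) < M⁻¹
      exact inv_pos.mpr hM
    exact_mod_cast this
  have hps : HasFPowerSeriesOnBall p.sum p 0 ((Minv : NNReal) : ENNReal) :=
    (p.hasFPowerSeriesOnBall (hMinv_pos.trans_le hrad)).mono hMinv_pos hrad
  have hfun : p.sum = fun x => ∑' n, f n * x ^ n := by
    show FormalMultilinearSeries.ofScalarsSum (E := ℝ) f = _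
    rw [FormalMultilinearSeries.ofScalarsSum_eq_tsum]
    funext x
    refine tsum_congr fun n => ?_
    rw [smul_eq_mul, mul_comm]
  rw [← hfun]
  refine hps.analyticAt_of_mem ?_
  rw [Metric.eball_coe, Metric.mem_ball, Real.dist_eq, sub_zero]
  show |ξ| < M⁻¹
  calc |ξ| < 1 / (2 * M) := hξ
    _ ≤ M⁻¹ := by
        rw [div_le_iff₀ (by positivity), inv_mul_eq_div, le_div_iff₀ hM]
        linarith

/-- The Cauchy product of two series with geometric coefficient bounds:
`Σ (f ⋆ g)ₙ ξⁿ = (Σ fₙ ξⁿ)(Σ gₙ ξⁿ)`. [folklore] -/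
theorem hasSum_cauchy {f g : ℕ → ℝ} (hf : ∀ n, |f n| ≤ K * M ^ n)
    (hg : ∀ n, |g n| ≤ K * M ^ n) (hM : 0 ≤ M) {ξ : ℝ} (hξ : M * |ξ| ≤ 1 / 2) :
    HasSum (fun n => cauchy f g n * ξ ^ n) ((∑' n, f n * ξ ^ n) * (∑' n, g n * ξ ^ n)) := by
  have h := hasSum_sum_range_mul_of_summable_norm (summable_norm_term hf hM hξ)
    (summable_norm_term hg hM hξ)
  have e : ∀ n : ℕ, ∑ k ∈ range (n + 1), f k * ξ ^ k * (g (n - k) * ξ ^ (n - k))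
      = (∑ k ∈ range (n + 1), f k * g (n - k)) * ξ ^ n := by
    intro n
    rw [sum_mul]
    refine sum_congr rfl fun k hk => ?_
    rw [mem_range] at hk
    rw [← pow_mul_pow_sub ξ (Nat.lt_succ_iff.mp hk)]
    ring
  simp only [e] at h
  exact h

/-- The product of an absolutely convergent series `Σ dₙ ξⁿ = D` with a derivative series:
`Σₙ (Σ_{k≤n} d_k (n−k+1) g_{n−k+1}) ξⁿ = D · (Σ gₙ xⁿ)′(ξ)`. [folklore] -/
theorem hasSum_mul_deriv {d g : ℕ → ℝ} {D : ℝ} {ξ : ℝ} (hd : Summable fun n => ‖d n * ξ ^ n‖)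
    (hD : HasSum (fun n => d n * ξ ^ n) D) (hg : ∀ n, |g n| ≤ K * M ^ n) (hM : 0 < M)
    (hξ : |ξ| < 1 / (2 * M)) :
    HasSum (fun n => (∑ k ∈ range (n + 1), d k * (((n - k : ℕ) : ℝ) + 1) * g (n - k + 1)) * ξ ^ n)
      (D * deriv (fun x => ∑' n, g n * x ^ n) ξ) := by
  have hξ' := half_of_lt hM hξ
  have h := hasSum_sum_range_mul_of_summable_norm hd (summable_norm_deriv_term hg hM.le hξ')
  rw [hD.tsum_eq, (hasSum_deriv_term hg hM hξ).tsum_eq] at h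
  refine h.congr_fun fun n => ?_
  show (∑ k ∈ range (n + 1), d k * (((n - k : ℕ) : ℝ) + 1) * g (n - k + 1)) * ξ ^ n
    = ∑ k ∈ range (n + 1), d k * ξ ^ k * ((((n - k : ℕ) : ℝ) + 1) * g (n - k + 1) * ξ ^ (n - k))
  rw [sum_mul]
  refine sum_congr rfl fun k hk => ?_
  rw [mem_range] at hk
  rw [← pow_mul_pow_sub ξ (Nat.lt_succ_iff.mp hk)]
  ring

end Generic

/-! ### The local solution `(W^{(r)}, Z^{(r)})` near `P_s` -/

/-- **`W^{(r)}` near `P_s`** as the sum of its Taylor series in `ξ` (`P_s` is `ξ = 0`).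
[cite: BuckmasterCaolaboraGomezserrano2025, Prop. 2.2, Prop. 2.3] -/
def Wloc (r : ℝ) (ξ : ℝ) : ℝ := ∑' n, w r n * ξ ^ n

/-- **`Z^{(r)}` near `P_s`** as the sum of its Taylor series in `ξ`.
[cite: BuckmasterCaolaboraGomezserrano2025, Prop. 2.2, Prop. 2.3] -/
def Zloc (r : ℝ) (ξ : ℝ) : ℝ := ∑' n, z r n * ξ ^ n

/-- [folklore] -/
theorem Wloc_def : Wloc r = fun x => ∑' n, w r n * x ^ n := rfl

/-- [folklore] -/
theorem Zloc_def : Zloc r = fun x => ∑' n, z r n * x ^ n := rfl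

/-- `W^{(r)}(0) = W₀`: the solution passes through `P_s`. [cite: BuckmasterCaolaboraGomezserrano2025, Prop. 2.2] -/
theorem Wloc_zero : Wloc r 0 = W0 r := by
  unfold Wloc; rw [tsum_term_zero, w_zero]

/-- `Z^{(r)}(0) = Z₀`. [cite: BuckmasterCaolaboraGomezserrano2025, Prop. 2.2] -/
theorem Zloc_zero : Zloc r 0 = Z0 r := by
  unfold Zloc; rw [tsum_term_zero, z_zero]

section Sum

variable {K M : ℝ}

/-- The series of `D_W(W,Z)` along the solution. [folklore] -/
theorem hasSum_dWc (hw : ∀ n, |w r n| ≤ K * M ^ n) (hz : ∀ n, |z r n| ≤ K * M ^ n)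
    (hM : 0 ≤ M) {ξ : ℝ} (hξ : M * |ξ| ≤ 1 / 2) :
    HasSum (fun n => dWc (w r) (z r) n * ξ ^ n) (DW (Wloc r ξ) (Zloc r ξ)) := by
  have hW := hasSum_term hw hM hξ
  have hZ := hasSum_term hz hM hξ
  have h := (hasSum_ite_eq 0 (1 : ℝ)).add (((hW.mul_left 2).add hZ).div_const 3)
  unfold DW Wloc Zloc
  refine h.congr_fun fun n => ?_
  show dWc (w r) (z r) n * ξ ^ n
    = (if n = 0 then 1 else 0) + (2 * (w r n * ξ ^ n) + z r n * ξ ^ n) / 3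
  unfold dWc
  rcases n with _ | n
  · simp
  · simp; ring

/-- The series of `D_Z(W,Z)` along the solution. [folklore] -/
theorem hasSum_dZc (hw : ∀ n, |w r n| ≤ K * M ^ n) (hz : ∀ n, |z r n| ≤ K * M ^ n)
    (hM : 0 ≤ M) {ξ : ℝ} (hξ : M * |ξ| ≤ 1 / 2) :
    HasSum (fun n => dZc (w r) (z r) n * ξ ^ n) (DZ (Wloc r ξ) (Zloc r ξ)) := by
  have hW := hasSum_term hw hM hξ
  have hZ := hasSum_term hz hM hξ
  have h := (hasSum_ite_eq 0 (1 : ℝ)).add ((hW.add (hZ.mul_left 2)).div_const 3)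
  unfold DZ Wloc Zloc
  refine h.congr_fun fun n => ?_
  show dZc (w r) (z r) n * ξ ^ n
    = (if n = 0 then 1 else 0) + (w r n * ξ ^ n + 2 * (z r n * ξ ^ n)) / 3
  unfold dZc
  rcases n with _ | n
  · simp
  · simp; ring

/-- Absolute summability of a coefficient series dominated by `𝟙_{n=0} + aₙ` (this covers
`D_{W,n}` and `D_{Z,n}`). [folklore] -/
theorem summable_norm_dc {d : ℕ → ℝ} (hd0 : |d 0| ≤ 1 + av r 0) (hd : ∀ n, |d (n + 1)| ≤ av r (n + 1))
    (hb : ∀ n, av r n ≤ K * M ^ n) (hM : 0 ≤ M) {ξ : ℝ} (hξ : M * |ξ| ≤ 1 / 2) :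
    Summable fun n => ‖d n * ξ ^ n‖ := by
  have hav : ∀ n, |av r n| ≤ K * M ^ n := fun n => by
    rw [abs_of_nonneg (av_nonneg n)]; exact hb n
  have hK : 0 ≤ K := nonneg_of_bound hav
  have h1 : Summable fun n : ℕ => (if n = 0 then (1 : ℝ) else 0) :=
    summable_of_ne_finset_zero (s := {0}) (fun n hn => by
      rw [Finset.mem_singleton] at hn; rw [if_neg hn])
  refine Summable.of_nonneg_of_le (fun n => norm_nonneg _) (fun n => ?_)
    (h1.add ((summable_geometric_of_lt_one (by norm_num) (by norm_num) :
      Summable fun n : ℕ => (1 / 2 : ℝ) ^ n).mul_left K))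
  rw [Real.norm_eq_abs]
  rcases n with _ | n
  · have h0 := hb 0
    simp only [pow_zero, mul_one, if_true] at h0 ⊢
    linarith
  · have ht := abs_term_le hav hM hξ (n + 1)
    rw [abs_mul, abs_of_nonneg (av_nonneg _)] at ht
    rw [if_neg (Nat.succ_ne_zero n), zero_add, abs_mul]
    exact le_trans (mul_le_mul_of_nonneg_right (hd n) (abs_nonneg _)) ht

/-- The series of `N_W(W,Z)` along the solution. [folklore] -/
theorem hasSum_nWc (hw : ∀ n, |w r n| ≤ K * M ^ n) (hz : ∀ n, |z r n| ≤ K * M ^ n)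
    (hM : 0 ≤ M) {ξ : ℝ} (hξ : M * |ξ| ≤ 1 / 2) :
    HasSum (fun n => nWc r (w r) (z r) n * ξ ^ n) (NW r (Wloc r ξ) (Zloc r ξ)) := by
  have hW := hasSum_term hw hM hξ
  have hWW := hasSum_cauchy hw hw hM hξ
  have hWZ := hasSum_cauchy hw hz hM hξ
  have hZZ := hasSum_cauchy hz hz hM hξ
  have h := (((hW.mul_left (-r)).sub (hWW.mul_left (5 / 6))).sub (hWZ.mul_left (1 / 3))).add
    (hZZ.mul_left (1 / 6))
  have e : NW r (Wloc r ξ) (Zloc r ξ) = -r * (∑' n, w r n * ξ ^ n)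
      - 5 / 6 * ((∑' n, w r n * ξ ^ n) * (∑' n, w r n * ξ ^ n))
      - 1 / 3 * ((∑' n, w r n * ξ ^ n) * (∑' n, z r n * ξ ^ n))
      + 1 / 6 * ((∑' n, z r n * ξ ^ n) * (∑' n, z r n * ξ ^ n)) := by
    unfold NW Wloc Zloc; ring
  rw [e]
  refine h.congr_fun fun n => ?_
  unfold nWc
  ring

/-- The series of `N_Z(W,Z)` along the solution. [folklore] -/
theorem hasSum_nZc (hw : ∀ n, |w r n| ≤ K * M ^ n) (hz : ∀ n, |z r n| ≤ K * M ^ n)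
    (hM : 0 ≤ M) {ξ : ℝ} (hξ : M * |ξ| ≤ 1 / 2) :
    HasSum (fun n => nZc r (w r) (z r) n * ξ ^ n) (NZ r (Wloc r ξ) (Zloc r ξ)) := by
  have hZ := hasSum_term hz hM hξ
  have hWW := hasSum_cauchy hw hw hM hξ
  have hWZ := hasSum_cauchy hw hz hM hξ
  have hZZ := hasSum_cauchy hz hz hM hξ
  have h := (((hZ.mul_left (-r)).sub (hWZ.mul_left (1 / 3))).sub (hZZ.mul_left (5 / 6))).add
    (hWW.mul_left (1 / 6))
  have e : NZ r (Wloc r ξ) (Zloc r ξ) = -r * (∑' n, z r n * ξ ^ n)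
      - 1 / 3 * ((∑' n, w r n * ξ ^ n) * (∑' n, z r n * ξ ^ n))
      - 5 / 6 * ((∑' n, z r n * ξ ^ n) * (∑' n, z r n * ξ ^ n))
      + 1 / 6 * ((∑' n, w r n * ξ ^ n) * (∑' n, w r n * ξ ^ n)) := by
    unfold NZ Wloc Zloc; ring
  rw [e]
  refine h.congr_fun fun n => ?_
  unfold nZc
  ring

/-- **`D_W(W,Z) W′ = N_W(W,Z)` along `(W^{(r)}, Z^{(r)})`** inside the radius, for `r < r*`
(the `W`-equation of (1.8), summed from `EW_wz`). [cite: BuckmasterCaolaboraGomezserrano2025, Prop. 2.2, Prop. 2.3] -/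
theorem DW_mul_deriv_Wloc (hr : r < rstar) (hb : ∀ n, av r n ≤ K * M ^ n) (hM : 0 < M) {ξ : ℝ}
    (hξ : |ξ| < 1 / (2 * M)) :
    DW (Wloc r ξ) (Zloc r ξ) * deriv (Wloc r) ξ = NW r (Wloc r ξ) (Zloc r ξ) := by
  have hw : ∀ n, |w r n| ≤ K * M ^ n := fun n => (abs_w_le_av n).trans (hb n)
  have hz : ∀ n, |z r n| ≤ K * M ^ n := fun n => (abs_z_le_av n).trans (hb n)
  have hξ' := half_of_lt hM hξ
  have hd : Summable fun n => ‖dWc (w r) (z r) n * ξ ^ n‖ :=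
    summable_norm_dc abs_dc_zero_le.1 abs_dWc_succ_le hb hM.le hξ'
  have hP := hasSum_mul_deriv hd (hasSum_dWc hw hz hM.le hξ') hw hM hξ
  have hN := hasSum_nWc (r := r) hw hz hM.le hξ'
  have hE := hP.sub hN
  have hE0 : HasSum (fun n => EW r (w r) (z r) n * ξ ^ n)
      (DW (Wloc r ξ) (Zloc r ξ) * deriv (Wloc r) ξ - NW r (Wloc r ξ) (Zloc r ξ)) := by
    rw [Wloc_def]
    refine hE.congr_fun fun n => ?_
    unfold EW
    ring
  simp only [EW_wz hr, zero_mul] at hE0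
  have := hE0.unique hasSum_zero
  linarith

/-- **`D_Z(W,Z) Z′ = N_Z(W,Z)` along `(W^{(r)}, Z^{(r)})`** inside the radius, for
`r ∈ (r₃, r₄)` (the `Z`-equation of (1.8), summed from `EZfull_wz`).
[cite: BuckmasterCaolaboraGomezserrano2025, Prop. 2.2, Prop. 2.3] -/
theorem DZ_mul_deriv_Zloc (h3 : r3 < r) (h4 : r < r4) (hb : ∀ n, av r n ≤ K * M ^ n) (hM : 0 < M)
    {ξ : ℝ} (hξ : |ξ| < 1 / (2 * M)) :
    DZ (Wloc r ξ) (Zloc r ξ) * deriv (Zloc r) ξ = NZ r (Wloc r ξ) (Zloc r ξ) := by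
  have hw : ∀ n, |w r n| ≤ K * M ^ n := fun n => (abs_w_le_av n).trans (hb n)
  have hz : ∀ n, |z r n| ≤ K * M ^ n := fun n => (abs_z_le_av n).trans (hb n)
  have hξ' := half_of_lt hM hξ
  have hd : Summable fun n => ‖dZc (w r) (z r) n * ξ ^ n‖ :=
    summable_norm_dc abs_dc_zero_le.2 (fun n => abs_dZc_two_le' n) hb hM.le hξ'
  have hP := hasSum_mul_deriv hd (hasSum_dZc hw hz hM.le hξ') hz hM hξ
  have hN := hasSum_nZc (r := r) hw hz hM.le hξ'
  have hE := hP.sub hN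
  have hE0 : HasSum (fun n => EZfull r (w r) (z r) n * ξ ^ n)
      (DZ (Wloc r ξ) (Zloc r ξ) * deriv (Zloc r) ξ - NZ r (Wloc r ξ) (Zloc r ξ)) := by
    rw [Zloc_def]
    refine hE.congr_fun fun n => ?_
    unfold EZfull
    ring
  simp only [EZfull_wz h3 h4, zero_mul] at hE0
  have := hE0.unique hasSum_zero
  linarith

end Sum

/-- The explicit radius `ρ(r) = 1/(2 geoM(r))` inside which everything below holds.
[cite: BuckmasterCaolaboraGomezserrano2025, Prop. 2.3] -/
def sonicRad (r : ℝ) : ℝ := 1 / (2 * geoM r)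

/-- [folklore] -/
theorem sonicRad_pos (hr : r < rstar) : 0 < sonicRad r := by
  unfold sonicRad
  have := four_le_geoM hr
  positivity

/-- **Propositions 2.2–2.3 of Buckmaster–Cao-Labora–Gómez-Serrano at `γ = 5/3`** (existence and
analyticity of the smooth branch through `P_s`), with the explicit radius `ρ(r) = sonicRad r`.
For `r ∈ (r₃, r₄)` the Taylor series `W^{(r)}(ξ) = Σ wₙ ξⁿ`, `Z^{(r)}(ξ) = Σ zₙ ξⁿ` built from the
recursion (2.9)–(2.10) converge for `|ξ| < ρ(r)`, define real-analytic functions there, pass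
through `P_s = (W₀, Z₀)` at `ξ = 0` with velocity `(W₁, Z₁)` (the direction `ν₋`), and solve the
autonomous system (1.8): `D_W(W,Z) W′ = N_W(W,Z)`, `D_Z(W,Z) Z′ = N_Z(W,Z)`.
[cite: BuckmasterCaolaboraGomezserrano2025, Prop. 2.2, Prop. 2.3] -/
theorem sonicSeries_spec' (h3 : r3 < r) (h4 : r < r4) :
    Wloc r 0 = W0 r ∧ Zloc r 0 = Z0 r ∧ deriv (Wloc r) 0 = W1 r ∧ deriv (Zloc r) 0 = Z1 r ∧
      ∀ ξ : ℝ, |ξ| < sonicRad r →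
        AnalyticAt ℝ (Wloc r) ξ ∧ AnalyticAt ℝ (Zloc r) ξ ∧
        DW (Wloc r ξ) (Zloc r ξ) * deriv (Wloc r) ξ = NW r (Wloc r ξ) (Zloc r ξ) ∧
        DZ (Wloc r ξ) (Zloc r ξ) * deriv (Zloc r) ξ = NZ r (Wloc r ξ) (Zloc r ξ) := by
  have hm := r3_r4_mem
  have hr : r < rstar := h4.trans hm.2.2
  have hM : 0 < geoM r := by linarith [four_le_geoM hr]
  have hb : ∀ n, av r n ≤ geoK r * geoM r ^ n := av_le_geom h3 h4
  have hw : ∀ n, |w r n| ≤ geoK r * geoM r ^ n := fun n => (abs_w_le_av n).trans (hb n)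
  have hz : ∀ n, |z r n| ≤ geoK r * geoM r ^ n := fun n => (abs_z_le_av n).trans (hb n)
  refine ⟨Wloc_zero, Zloc_zero, ?_, ?_, fun ξ hξ => ⟨?_, ?_, ?_, ?_⟩⟩
  · rw [Wloc_def, deriv_tsum_term_zero hw hM, w_one]
  · rw [Zloc_def, deriv_tsum_term_zero hz hM, z_one]
  · rw [Wloc_def]; exact analyticAt_tsum_term hw hM hξ
  · rw [Zloc_def]; exact analyticAt_tsum_term hz hM hξ
  · exact DW_mul_deriv_Wloc hr hb hM hξ
  · exact DZ_mul_deriv_Zloc h3 h4 hb hM hξ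

/-- Existential-radius form of `sonicSeries_spec'`. [cite: BuckmasterCaolaboraGomezserrano2025, Prop. 2.2, Prop. 2.3] -/
theorem sonicSeries_spec (h3 : r3 < r) (h4 : r < r4) :
    ∃ ρ : ℝ, 0 < ρ ∧
      Wloc r 0 = W0 r ∧ Zloc r 0 = Z0 r ∧ deriv (Wloc r) 0 = W1 r ∧ deriv (Zloc r) 0 = Z1 r ∧
      ∀ ξ : ℝ, |ξ| < ρ →
        AnalyticAt ℝ (Wloc r) ξ ∧ AnalyticAt ℝ (Zloc r) ξ ∧
        DW (Wloc r ξ) (Zloc r ξ) * deriv (Wloc r) ξ = NW r (Wloc r ξ) (Zloc r ξ) ∧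
        DZ (Wloc r ξ) (Zloc r ξ) * deriv (Zloc r) ξ = NZ r (Wloc r ξ) (Zloc r ξ) :=
  ⟨sonicRad r, sonicRad_pos (h4.trans r3_r4_mem.2.2), sonicSeries_spec' h3 h4⟩

/-- Near `ξ = 0` the solution stays off the sonic line `{D_W = 0}` (`D_W(P_s) > 0`), and off
`{D_Z = 0}` for `ξ ≠ 0` small (`D_Z(P_s) = 0` but `(d/dξ) D_Z(W^{(r)}, Z^{(r)})(0) = D_{Z,1} > 0`):
there (1.8) holds in the resolved form `W′ = N_W/D_W`, `Z′ = N_Z/D_Z`.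
[cite: BuckmasterCaolaboraGomezserrano2025, Prop. 2.2, Prop. 2.3] -/
theorem sonicSeries_offSonic (h3 : r3 < r) (h4 : r < r4) :
    (∀ᶠ ξ in 𝓝 (0 : ℝ), 0 < DW (Wloc r ξ) (Zloc r ξ)) ∧
    (∀ᶠ ξ in 𝓝[≠] (0 : ℝ), DZ (Wloc r ξ) (Zloc r ξ) ≠ 0) ∧
    ∀ᶠ ξ in 𝓝[≠] (0 : ℝ),
      HasDerivAt (Wloc r) (NW r (Wloc r ξ) (Zloc r ξ) / DW (Wloc r ξ) (Zloc r ξ)) ξ ∧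
      HasDerivAt (Zloc r) (NZ r (Wloc r ξ) (Zloc r ξ) / DZ (Wloc r ξ) (Zloc r ξ)) ξ := by
  have hm := r3_r4_mem
  have hr : r < rstar := h4.trans hm.2.2
  have hr2 : r < 2 := by linarith [rstar_lt]
  obtain ⟨ρ, hρ, hW0, hZ0, hW1, hZ1, hspec⟩ := sonicSeries_spec h3 h4
  have hball : ∀ᶠ ξ in 𝓝 (0 : ℝ), |ξ| < ρ := by
    have : Set.Iio ρ ∈ 𝓝 (|(0 : ℝ)|) := by rw [abs_zero]; exact Iio_mem_nhds hρ
    exact continuous_abs.continuousAt.preimage_mem_nhds this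
  have h0 := hspec 0 (by rw [abs_zero]; exact hρ)
  have hcW : ContinuousAt (Wloc r) 0 := h0.1.continuousAt
  have hcZ : ContinuousAt (Zloc r) 0 := h0.2.1.continuousAt
  -- `D_W > 0` near `0`
  have hDW : ∀ᶠ ξ in 𝓝 (0 : ℝ), 0 < DW (Wloc r ξ) (Zloc r ξ) := by
    have hc : ContinuousAt (fun ξ => DW (Wloc r ξ) (Zloc r ξ)) 0 := by
      unfold DW
      exact continuousAt_const.add (((continuousAt_const.mul hcW).add hcZ).div_const _)
    have hpos : 0 < DW (Wloc r 0) (Zloc r 0) := by rw [hW0, hZ0]; exact DW_Ps_pos hr2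
    exact hc.preimage_mem_nhds (Ioi_mem_nhds hpos)
  -- `D_Z ≠ 0` on a punctured neighbourhood of `0`
  have hDZ : ∀ᶠ ξ in 𝓝[≠] (0 : ℝ), DZ (Wloc r ξ) (Zloc r ξ) ≠ 0 := by
    have hdW : HasDerivAt (Wloc r) (W1 r) 0 := hW1 ▸ h0.1.differentiableAt.hasDerivAt
    have hdZ : HasDerivAt (Zloc r) (Z1 r) 0 := hZ1 ▸ h0.2.1.differentiableAt.hasDerivAt
    have hd : HasDerivAt (fun ξ => DZ (Wloc r ξ) (Zloc r ξ)) ((W1 r + 2 * Z1 r) / 3) 0 := by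
      unfold DZ
      exact (hasDerivAt_const _ _).add ((hdW.add (hdZ.const_mul 2)).div_const 3) |>.congr_deriv
        (by ring)
    have hne : (W1 r + 2 * Z1 r) / 3 ≠ 0 := by
      have := DZ1_pos hr
      have e := DZ1_eq r
      intro h
      linarith
    have := hd.eventually_ne hne (c := 0)
    exact this
  refine ⟨hDW, hDZ, ?_⟩
  have hball' : ∀ᶠ ξ in 𝓝[≠] (0 : ℝ), |ξ| < ρ := nhdsWithin_le_nhds hball
  have hDW' : ∀ᶠ ξ in 𝓝[≠] (0 : ℝ), 0 < DW (Wloc r ξ) (Zloc r ξ) := nhdsWithin_le_nhds hDW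
  filter_upwards [hball', hDW', hDZ] with ξ hξ hDWξ hDZξ
  obtain ⟨hAW, hAZ, hEW, hEZ⟩ := hspec ξ hξ
  have hdW : HasDerivAt (Wloc r) (deriv (Wloc r) ξ) ξ := hAW.differentiableAt.hasDerivAt
  have hdZ : HasDerivAt (Zloc r) (deriv (Zloc r) ξ) ξ := hAZ.differentiableAt.hasDerivAt
  constructor
  · convert hdW using 1
    field_simp
    linarith [hEW]
  · convert hdZ using 1
    field_simp
    linarith [hEZ]

end SonicSeries

end Monatomic

end BuckmasterCaolaboraGomezserrano2025

end Literature.Analysis.FluidPDE
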